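/-
Copyright (c) 2026 the pub-hodgecm-mathlib formalisation cell (harness21).  Prover seat hodgecm-mathlib-F0P3a-p03 (g17): «S3-ram» seeding wave (LEAD F0P3a-plan (g12)
T11-79 (3) «(d-vi) anisotropic side — go»; owner F0P3a-p06 (g15)), (α₂) A₂ (d) design of F0P3a-p07 (g13) v1.1∕v1.2, row «(d-vi) ANISOTROPIC SIDE `t₁`»; 2026-09-02.
-/
import Literature.NumberTheory.Automorphic.UnitaryLatticeTreeSeparableStableRoot                 -- ★ p847156 (F0P3a-p01): `isSelfDualLattice_stdLattice_diagonal`; brings ★ `UnitaryLatticeTreeTypes` ∕ `Dual` ∕ `Defs`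
import Literature.NumberTheory.Rogawski1990.UnitaryVertexStabilizerSpanSelfDualTameRamifiedCM    -- ★ p846371 (F0P3a-p07): `ramifiedBlock_adicCompletion` (the (norm)-with-level clause at a tame-ramified `w`)
import Literature.NumberTheory.LocalFields.RamifiedPlaceUnitNorms                               -- ★ p846833 (F0P2-p01): (U2) `exists_fixed_unit_not_norm_of_ramified_complexConj`
import HarnessLib

/-!
# The lattice graph of a residually ANISOTROPIC unimodular hermitian plane is a single vertex: the only vertex lattice is the root `L₀`, and every primitive vector of `L₀`
# is anisotropic (Bruhat–Tits 1972 §10: the building of an anisotropic group is a point; Jacobowitz 1962 §7)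

Topic `NumberTheory/Automorphic`; namespace `Literature.NumberTheory.Automorphic.UnitaryLatticeTree`.  THEOREMS ONLY (no definition, no instance, no notation, no named fact,
no `sorry`); kernel lane `--supports stmt-HodgeConjecture-24833`; datum-free (`K` with `Valued K ℤᵐ⁰`, `σ` valuation-preserving) plus a CM dress (§5).  Cell `pub/hodgecm-mathlib`
(D-0151), crux H413; road «S3-ram» (Literature seeding, count-neutral), the type-(2) population (α₂) A₂ (d) «TYPE-(2) G-SIDE COUNTS» (design F0P3a-p07 (g13) v1.1 2cbc0f07 §2 ∕ v1.2,
architect A-p12 (g23)), row **(d-vi) ANISOTROPIC SIDE**: the `t₁` literal of CERT P2ram 09bbc9d7 (B-p14 (g38)) lives on the ANISOTROPIC plane `W′ = y^⊥` with Gram `diag(−ε, 1)`, `ε` a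
σ_w-fixed NON-NORM unit; p07's histogram law (L1) `#{a = 0}(t₁) = 1` («`U(W′)` compact: the `t₁` axis is the root») and (L3)∕(L4) «ALL `(q+1)q` collar grandchildren» are the two
facts typed here: in `W′` there is EXACTLY ONE vertex lattice, `S₀ = L₀`, and ALL `q + 1` residual directions of `S₀` are anisotropic — so A-p12 (g23)'s form-generic (d-v-dict)
heads (i)(ii)(iv) apply on `W′` with the self-dual `S` forced to be `L₀` and the «`x̄₀` anisotropic» condition vacuous (count `(q+1)q^{a−1}` cyclic-cotype-`2a` pairs per `a ≥ 1`).

THE MATHEMATICS.  `H = diag(d₀, d₁)` with unit entries on `K²`, RESIDUALLY ANISOTROPIC in valuation currency: `|d₀ + d₁·σc·c| = 1` and `|d₀·σc·c + d₁| = 1` for integral `c` (the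
residual form does not represent `0`; e.g. `diag(−ε, 1)`, `ε` a non-norm unit, §4).  (§1) `|h(x, x)| = max(|x₀|, |x₁|)²` for `x ≠ 0`.  (§2) An `𝒪`-module with integral self-pairings
lies in `L₀ = 𝒪²`, and so does its dual once `ϖ M^♯ ⊆ M` (`|h(y,y)| ≤ |ϖ|⁻¹` forces `max |y_i|² ≤ exp(1)`, i.e. `≤ 1`: valuations are integral powers).  (§3) A VERTEX LATTICE
(`ϖM^♯ ≤ M ≤ M^♯`, `M = latt g`) has `M ≤ L₀ ≤ M^♯ ≤ L₀`, so `M^♯ = L₀` and `M = M^♯♯ = L₀` (★ `dualLatt_dualLatt_latt`, ★ `dualLatt_stdLattice_eq_self`): **the only vertex of the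
lattice graph of `(K², H)` is `L₀`**, and every `x ∈ L₀ ∖ ϖL₀` has `|h(x,x)| = 1`.  (§4) `diag(−ε, 1)` with `σε = ε`, `|ε| = 1`, `ε` NOT a norm, plus the clause «σ-fixed `u ≡ 1 (mod 𝔪)`
is a norm» (★ `ramifiedBlock_adicCompletion`) is residually anisotropic: `N(c) ≡ ε` or `εN(c) ≡ 1` would make `ε` a norm.  (§5) The CM dress with (U2)'s non-norm unit `η` (★ p846833).
HONEST LABEL: HC_CM is proved only modulo the 2 remaining named inputs (hLiu418 24832, h413 24833) until rung 0 closes; nothing printed is asserted here (elementary lattice algebra).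

## References
* [BruhatTits1972] F. Bruhat, J. Tits, *Groupes réductifs sur un corps local I*, Publ. Math. IHÉS 41 (1972), §10.  [Jacobowitz1962] R. Jacobowitz, *Hermitian forms over local
  fields*, Amer. J. Math. 84 (1962), §7 Thm. 7.1, §8.  [Serre1980Trees] J.-P. Serre, *Trees* (1980), Ch. II §1.1.  [LabesseLanglands1979] J.-P. Labesse, R. P. Langlands,
  *L-indistinguishability for SL(2)*, Canad. J. Math. 31 (1979), §2 pp. 8–10 (the anisotropic torus at a ramified place).  [Serre1979] J.-P. Serre, *Local Fields*, Ch. V §3.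
-/

set_option autoImplicit false

noncomputable section

open NumberField IsDedekindDomain
open scoped Valued WithZero Matrix MatrixGroups

namespace Literature.NumberTheory.Automorphic.UnitaryLatticeTree

open Literature.NumberTheory.Automorphic Literature.NumberTheory.Automorphic.HermitianLattice

variable {K : Type*} [Field K] [Valued K ℤᵐ⁰]

/-! ## §1 The self-pairing of a residually anisotropic diagonal unit plane: `|h(x,x)| = max(|x₀|, |x₁|)²` -/

section Anisotropic

variable {σ : K →+* K} (hvσ : ∀ a, Valued.v (σ a) = Valued.v a) {d : Fin 2 → K}
  (hanis₀ : ∀ c : K, Valued.v c ≤ 1 → Valued.v (d 0 + d 1 * (σ c * c)) = 1)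
  (hanis₁ : ∀ c : K, Valued.v c ≤ 1 → Valued.v (d 0 * (σ c * c) + d 1) = 1)

omit [Valued K ℤᵐ⁰] in
/-- The self-pairing of the diagonal plane: `h(x,x) = σx₀·d₀·x₀ + σx₁·d₁·x₁`. [cite: Jacobowitz1962, §4] -/
theorem pairing_diagonal_two_self (σ : K →+* K) (d : Fin 2 → K) (x : Fin 2 → K) :
    pairing σ (Matrix.diagonal d) x x = σ (x 0) * d 0 * x 0 + σ (x 1) * d 1 * x 1 := by
  rw [pairing_apply, Fin.sum_univ_two, Fin.sum_univ_two, Fin.sum_univ_two, Matrix.diagonal_apply_eq, Matrix.diagonal_apply_eq,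
    Matrix.diagonal_apply_ne _ (by decide : (0 : Fin 2) ≠ 1), Matrix.diagonal_apply_ne _ (by decide : (1 : Fin 2) ≠ 0)]
  ring

include hvσ hanis₀ in
/-- If `|x₁| ≤ |x₀|`, `x₀ ≠ 0`: `|h(x,x)| = |x₀|²` (factor `h(x,x) = N(x₀)·(d₀ + d₁N(x₁∕x₀))`). [cite: Jacobowitz1962, §7] [cite: BruhatTits1972, §10] -/
theorem valued_pairing_self_eq_sq_of_le_fst {x : Fin 2 → K} (h0 : x 0 ≠ 0) (hle : Valued.v (x 1) ≤ Valued.v (x 0)) :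
    Valued.v (pairing σ (Matrix.diagonal d) x x) = Valued.v (x 0) * Valued.v (x 0) := by
  set c : K := x 1 * (x 0)⁻¹ with hc
  have hc1 : Valued.v c ≤ 1 := by
    rw [hc, Valuation.map_mul, map_inv₀]
    calc Valued.v (x 1) * (Valued.v (x 0))⁻¹ ≤ Valued.v (x 0) * (Valued.v (x 0))⁻¹ := mul_le_mul' hle le_rfl
      _ = 1 := mul_inv_cancel₀ ((Valuation.ne_zero_iff _).2 h0)
  have hx1 : x 1 = c * x 0 := by rw [hc, inv_mul_cancel_right₀ h0]
  have e : pairing σ (Matrix.diagonal d) x x = (σ (x 0) * x 0) * (d 0 + d 1 * (σ c * c)) := by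
    rw [pairing_diagonal_two_self, hx1, map_mul]; ring
  rw [e, Valuation.map_mul, Valuation.map_mul, hvσ, hanis₀ c hc1, mul_one]

include hvσ hanis₁ in
/-- If `|x₀| ≤ |x₁|`, `x₁ ≠ 0`: `|h(x,x)| = |x₁|²`. [cite: Jacobowitz1962, §7] [cite: BruhatTits1972, §10] -/
theorem valued_pairing_self_eq_sq_of_le_snd {x : Fin 2 → K} (h1 : x 1 ≠ 0) (hle : Valued.v (x 0) ≤ Valued.v (x 1)) :
    Valued.v (pairing σ (Matrix.diagonal d) x x) = Valued.v (x 1) * Valued.v (x 1) := by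
  set c : K := x 0 * (x 1)⁻¹ with hc
  have hc1 : Valued.v c ≤ 1 := by
    rw [hc, Valuation.map_mul, map_inv₀]
    calc Valued.v (x 0) * (Valued.v (x 1))⁻¹ ≤ Valued.v (x 1) * (Valued.v (x 1))⁻¹ := mul_le_mul' hle le_rfl
      _ = 1 := mul_inv_cancel₀ ((Valuation.ne_zero_iff _).2 h1)
  have hx0 : x 0 = c * x 1 := by rw [hc, inv_mul_cancel_right₀ h1]
  have e : pairing σ (Matrix.diagonal d) x x = (σ (x 1) * x 1) * (d 0 * (σ c * c) + d 1) := by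
    rw [pairing_diagonal_two_self, hx0, map_mul]; ring
  rw [e, Valuation.map_mul, Valuation.map_mul, hvσ, hanis₁ c hc1, mul_one]

include hvσ hanis₀ hanis₁ in
/-- **`|h(x,x)| = max(|x₀|, |x₁|)²` for `x ≠ 0`** on a residually anisotropic diagonal unit plane. [cite: Jacobowitz1962, §7] [cite: BruhatTits1972, §10] -/
theorem valued_pairing_self_eq_max_sq {x : Fin 2 → K} (hx : x ≠ 0) :
    Valued.v (pairing σ (Matrix.diagonal d) x x) = max (Valued.v (x 0)) (Valued.v (x 1)) * max (Valued.v (x 0)) (Valued.v (x 1)) := by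
  rcases le_total (Valued.v (x 1)) (Valued.v (x 0)) with hle | hle
  · have h0 : x 0 ≠ 0 := by
      intro h0
      apply hx; ext i; fin_cases i
      · exact h0
      · have : Valued.v (x 1) ≤ 0 := by rw [h0, map_zero] at hle; exact hle
        exact (Valuation.zero_iff _).1 (le_zero_iff.1 this)
    rw [max_eq_left hle, valued_pairing_self_eq_sq_of_le_fst hvσ hanis₀ h0 hle]
  · have h1 : x 1 ≠ 0 := by
      intro h1
      apply hx; ext i; fin_cases i
      · have : Valued.v (x 0) ≤ 0 := by rw [h1, map_zero] at hle; exact hle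
        exact (Valuation.zero_iff _).1 (le_zero_iff.1 this)
      · exact h1
    rw [max_eq_right hle, valued_pairing_self_eq_sq_of_le_snd hvσ hanis₁ h1 hle]

include hvσ hanis₀ hanis₁ in
/-- **EVERY PRIMITIVE VECTOR OF `L₀` IS ANISOTROPIC**: `x ∈ 𝒪²` with a unit coordinate has `|h(x,x)| = 1` — ALL `q + 1` residual directions of the root are anisotropic
(the «`x̄₀` anisotropic» condition of the cyclic-cotype dictionary is vacuous on the anisotropic plane). [cite: Jacobowitz1962, §7] [cite: LabesseLanglands1979, §2 p. 9] -/
theorem valued_pairing_self_eq_one_of_primitive {x : Fin 2 → K} (hx : x ∈ stdLattice K 2) (hprim : ∃ i, Valued.v (x i) = 1) :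
    Valued.v (pairing σ (Matrix.diagonal d) x x) = 1 := by
  obtain ⟨i, hi⟩ := hprim
  have hx0 : x ≠ 0 := fun h => by rw [h, Pi.zero_apply, map_zero] at hi; exact zero_ne_one hi
  have hmax : max (Valued.v (x 0)) (Valued.v (x 1)) = 1 := by
    refine le_antisymm (max_le ((mem_stdLattice).1 hx 0) ((mem_stdLattice).1 hx 1)) ?_
    fin_cases i
    · exact hi.symm.le.trans (le_max_left _ _)
    · exact hi.symm.le.trans (le_max_right _ _)
  rw [valued_pairing_self_eq_max_sq hvσ hanis₀ hanis₁ hx0, hmax, mul_one]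

/-! ## §2 Integral self-pairings force `M ≤ L₀`; `ϖM^♯ ≤ M` forces `M^♯ ≤ L₀` -/

include hvσ hanis₀ hanis₁ in
/-- A vector with `|h(x,x)| ≤ |c|²·` … precisely: `|h(x,x)| ≤ b·b` with `b = exp(n)` ⇒ `|x_i| ≤ b`. Used with `b = 1`. [cite: BruhatTits1972, §10] -/
theorem valued_apply_le_of_valued_pairing_self_le {x : Fin 2 → K} {b : ℤᵐ⁰}
    (h : Valued.v (pairing σ (Matrix.diagonal d) x x) ≤ b * b) (i : Fin 2) : Valued.v (x i) ≤ b := by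
  by_cases hx : x = 0
  · rw [hx, Pi.zero_apply, map_zero]; exact zero_le
  rw [valued_pairing_self_eq_max_sq hvσ hanis₀ hanis₁ hx] at h
  have hm : max (Valued.v (x 0)) (Valued.v (x 1)) ≤ b := by
    by_contra hlt
    rw [not_le] at hlt
    exact absurd h (not_le.2 (mul_lt_mul'' hlt hlt zero_le zero_le))
  fin_cases i
  · exact (le_max_left _ _).trans hm
  · exact (le_max_right _ _).trans hm

include hvσ hanis₀ hanis₁ in
/-- **INTEGRAL SELF-PAIRINGS ⇒ INSIDE THE ROOT**: if `|h(x,x)| ≤ 1` for every `x ∈ M` then `M ≤ L₀ = 𝒪²`. [cite: BruhatTits1972, §10] [cite: Jacobowitz1962, §7] -/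
theorem le_stdLattice_of_forall_valued_pairing_self_le_one {M : Submodule 𝒪[K] (Fin 2 → K)}
    (hM : ∀ x ∈ M, Valued.v (pairing σ (Matrix.diagonal d) x x) ≤ 1) : M ≤ stdLattice K 2 := fun x hx =>
  (mem_stdLattice).2 fun i => valued_apply_le_of_valued_pairing_self_le hvσ hanis₀ hanis₁ (by rw [mul_one]; exact hM x hx) i

include hvσ hanis₀ hanis₁ in
/-- `M ≤ M^♯ ⇒ M ≤ L₀`. [cite: BruhatTits1972, §10] [cite: Jacobowitz1962, §7] -/
theorem le_stdLattice_of_le_dualLatt_of_anisotropic {M : Submodule 𝒪[K] (Fin 2 → K)} (hMd : M ≤ dualLatt σ (Matrix.diagonal d) M) :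
    M ≤ stdLattice K 2 :=
  le_stdLattice_of_forall_valued_pairing_self_le_one hvσ hanis₀ hanis₁ fun x hx => (mem_dualLatt σ _ M x).1 (hMd hx) x hx

include hvσ hanis₀ hanis₁ in
/-- **`ϖ M^♯ ≤ M ⇒ M^♯ ≤ L₀`** (`|ϖ| = exp(−1)`): for `y ∈ M^♯`, `ϖy ∈ M` pairs integrally with `y`, so `|h(y,y)| ≤ exp(1) < exp(2)` and `max|y_i| ≤ 1` (valuations are integral powers).
[cite: BruhatTits1972, §10] [cite: Serre1980Trees, II.1.1] -/
theorem dualLatt_le_stdLattice_of_scaleLattice_dualLatt_le {ϖ : K} (hϖ : Valued.v ϖ = WithZero.exp (-1 : ℤ)) {M : Submodule 𝒪[K] (Fin 2 → K)}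
    (hM : scaleLattice ϖ (dualLatt σ (Matrix.diagonal d) M) ≤ M) : dualLatt σ (Matrix.diagonal d) M ≤ stdLattice K 2 := by
  have hϖ0 : ϖ ≠ 0 := fun h => by rw [h, map_zero] at hϖ; exact WithZero.coe_ne_zero hϖ.symm
  intro y hy
  have hϖy : ϖ • y ∈ M := hM (by
    rw [mem_scaleLattice_iff hϖ0, inv_smul_smul₀ hϖ0]; exact hy)
  have hpair := (mem_dualLatt σ _ M y).1 hy (ϖ • y) hϖy
  have e : pairing σ (Matrix.diagonal d) (ϖ • y) y = σ ϖ * pairing σ (Matrix.diagonal d) y y := by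
    rw [LinearMap.map_smulₛₗ₂, smul_eq_mul]
  rw [e, Valuation.map_mul, hvσ, hϖ] at hpair
  by_cases hy0 : y = 0
  · rw [hy0]; exact Submodule.zero_mem _
  have hle : Valued.v (pairing σ (Matrix.diagonal d) y y) ≤ WithZero.exp (1 : ℤ) :=
    calc Valued.v (pairing σ (Matrix.diagonal d) y y)
        = WithZero.exp (1 : ℤ) * (WithZero.exp (-1 : ℤ) * Valued.v (pairing σ (Matrix.diagonal d) y y)) := by
          rw [← mul_assoc, ← WithZero.exp_add, add_neg_cancel, WithZero.exp_zero, one_mul]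
      _ ≤ WithZero.exp (1 : ℤ) * 1 := mul_le_mul' le_rfl hpair
      _ = WithZero.exp (1 : ℤ) := mul_one _
  rw [valued_pairing_self_eq_max_sq hvσ hanis₀ hanis₁ hy0] at hle
  set m := max (Valued.v (y 0)) (Valued.v (y 1)) with hm
  have hm0 : m ≠ 0 := by
    intro h0
    apply hy0; ext i; fin_cases i
    · exact (Valuation.zero_iff _).1 (le_zero_iff.1 ((le_max_left (Valued.v (y 0)) (Valued.v (y 1))).trans h0.le))
    · exact (Valuation.zero_iff _).1 (le_zero_iff.1 ((le_max_right (Valued.v (y 0)) (Valued.v (y 1))).trans h0.le))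
  have hm1 : m ≤ 1 := by
    obtain ⟨n, hn⟩ : ∃ n : ℤ, m = WithZero.exp n := ⟨WithZero.log m, (WithZero.exp_log hm0).symm⟩
    rw [hn] at hle ⊢
    rw [← WithZero.exp_add, WithZero.exp_le_exp] at hle
    rw [← WithZero.exp_zero, WithZero.exp_le_exp]
    omega
  exact (mem_stdLattice).2 fun i => by
    fin_cases i
    · exact (le_max_left _ _).trans hm1
    · exact (le_max_right _ _).trans hm1

end Anisotropic

/-! ## §3 HEADS: the only vertex of the anisotropic plane is `L₀` -/

section Heads

variable {σ : K →+* K} (hσ : ∀ a, σ (σ a) = a) (hvσ : ∀ a, Valued.v (σ a) = Valued.v a) {d : Fin 2 → K} (hd : ∀ i, Valued.v (d i) = 1)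
  (hanis₀ : ∀ c : K, Valued.v c ≤ 1 → Valued.v (d 0 + d 1 * (σ c * c)) = 1)
  (hanis₁ : ∀ c : K, Valued.v c ≤ 1 → Valued.v (d 0 * (σ c * c) + d 1) = 1)

include hvσ hd hanis₀ hanis₁ in
/-- **THE ONLY SELF-DUAL LATTICE OF A RESIDUALLY ANISOTROPIC UNIMODULAR PLANE IS THE ROOT**: `IsSelfDualLattice σ ϖ diag(d) M ⇒ M = L₀` — p07 (g13)'s histogram law (L1)
`#{a = 0}(t₁) = 1`. [cite: BruhatTits1972, §10] [cite: Jacobowitz1962, §7 Thm. 7.1] -/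
theorem eq_stdLattice_of_isSelfDualLattice_of_anisotropic {ϖ : K} (hϖ0 : ϖ ≠ 0) (hϖ1 : Valued.v ϖ ≤ 1) {M : Submodule 𝒪[K] (Fin 2 → K)}
    (hM : IsSelfDualLattice σ ϖ (Matrix.diagonal d) M) : M = stdLattice K 2 :=
  eq_of_le_of_isVertexLattice hvσ hϖ0 hM (isSelfDualLattice_stdLattice_diagonal σ hϖ1 hd)
    (le_stdLattice_of_le_dualLatt_of_anisotropic hvσ hanis₀ hanis₁ (le_dualLatt_of_isVertexLattice hvσ hM))

include hσ hvσ hd hanis₀ hanis₁ in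
/-- **THE LATTICE GRAPH OF A RESIDUALLY ANISOTROPIC UNIMODULAR PLANE IS A SINGLE VERTEX** (`|ϖ| = exp(−1)`, `σ` an involution, `H = diag(d)` σ-hermitian): every vertex lattice `M`
(of ANY type: `ϖM^♯ ≤ M ≤ M^♯`) is the root `L₀` — `M ≤ L₀ ≤ M^♯ ≤ L₀`, so `M^♯ = L₀` and `M = M^♯♯ = L₀`.  (The building of the anisotropic `U(H)` is a point; no `ϖ`-modular
vertex: the discriminant `−d₀d₁` is not a norm class of a hyperbolic plane.) [cite: BruhatTits1972, §10] [cite: Jacobowitz1962, §8] [cite: Serre1980Trees, II.1.1] -/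
theorem eq_stdLattice_of_isVertex_of_anisotropic (hH : ((Matrix.diagonal d).map σ)ᵀ = Matrix.diagonal d) {ϖ : K} (hϖ : Valued.v ϖ = WithZero.exp (-1 : ℤ))
    {M : Submodule 𝒪[K] (Fin 2 → K)} (hM : IsVertex σ ϖ (Matrix.diagonal d) M) : M = stdLattice K 2 := by
  obtain ⟨t, hMt⟩ := hM
  have hne : ∀ i, d i ≠ 0 := fun i h0 => by have := hd i; rw [h0, map_zero] at this; exact zero_ne_one this
  have hHu : IsUnit (Matrix.diagonal d).det := by
    rw [Matrix.det_diagonal, isUnit_iff_ne_zero]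
    exact Finset.prod_ne_zero_iff.2 fun i _ => hne i
  have hHi : IsIntMatrix (Matrix.diagonal d) := fun i j => by
    by_cases hij : i = j
    · subst hij; rw [Matrix.diagonal_apply_eq]; exact (hd i).le
    · rw [Matrix.diagonal_apply_ne _ hij, map_zero]; exact zero_le
  have hinv : (Matrix.diagonal d)⁻¹ = Matrix.diagonal fun i => (d i)⁻¹ := by
    refine Matrix.inv_eq_left_inv ?_
    rw [Matrix.diagonal_mul_diagonal]
    convert Matrix.diagonal_one with i
    exact inv_mul_cancel₀ (hne i)
  have hHi' : IsIntMatrix (Matrix.diagonal d)⁻¹ := fun i j => by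
    rw [hinv]
    by_cases hij : i = j
    · subst hij; rw [Matrix.diagonal_apply_eq, map_inv₀, hd, inv_one]
    · rw [Matrix.diagonal_apply_ne _ hij, map_zero]; exact zero_le
  -- `M ≤ L₀`, `ϖM^♯ ≤ M`, hence `M^♯ ≤ L₀`; and `L₀ = L₀^♯ ≤ M^♯`
  have hMd : M ≤ dualLatt σ (Matrix.diagonal d) M := le_dualLatt_of_isVertexLattice hvσ hMt
  have hϖM : scaleLattice ϖ (dualLatt σ (Matrix.diagonal d) M) ≤ M := scaleLattice_dualLatt_le_of_isVertexLattice hvσ hHu hMt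
  have hML : M ≤ stdLattice K 2 := le_stdLattice_of_le_dualLatt_of_anisotropic hvσ hanis₀ hanis₁ hMd
  have hdual : dualLatt σ (Matrix.diagonal d) M = stdLattice K 2 := by
    refine le_antisymm (dualLatt_le_stdLattice_of_scaleLattice_dualLatt_le hvσ hanis₀ hanis₁ hϖ hϖM) ?_
    calc stdLattice K 2 = dualLatt σ (Matrix.diagonal d) (stdLattice K 2) := (dualLatt_stdLattice_eq_self σ hvσ hHu hHi hHi').symm
      _ ≤ dualLatt σ (Matrix.diagonal d) M := dualLatt_antitone σ _ hML
  -- `M = M^♯♯ = L₀^♯ = L₀`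
  obtain ⟨g, hMg, -, -, -⟩ := hMt
  calc M = dualLatt σ (Matrix.diagonal d) (dualLatt σ (Matrix.diagonal d) M) := by
        rw [hMg]; exact (dualLatt_dualLatt_latt σ hσ hvσ hHu hH (Matrix.isUnits_det_units g)).symm
    _ = dualLatt σ (Matrix.diagonal d) (stdLattice K 2) := by rw [hdual]
    _ = stdLattice K 2 := dualLatt_stdLattice_eq_self σ hvσ hHu hHi hHi'

end Heads

/-! ## §4 A NON-NORM σ-fixed unit makes `diag(−ε, 1)` residually anisotropic (given the (norm)-with-level clause) -/

section NonNorm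

variable {σ : K →+* K} (hσ : ∀ a, σ (σ a) = a) (hvσ : ∀ a, Valued.v (σ a) = Valued.v a)
  {ε : K} (hσε : σ ε = ε) (hε1 : Valued.v ε = 1) (hεn : ¬ ∃ z : K, z * σ z = ε)
  (hnorm : ∀ u : K, σ u = u → Valued.v (u - 1) < 1 → ∃ z : K, z * σ z = u)

include hσ hvσ hσε hε1 hεn hnorm in
/-- `|−ε + N(c)| = 1` for integral `c`: otherwise `u := ε∕N(c) ≡ 1` is σ-fixed, hence a norm (clause (norm)), and `ε = N(zc)`. [cite: Serre1979, Ch. V §3] [cite: LabesseLanglands1979, §2 p. 9] -/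
theorem valued_neg_add_norm_eq_one_of_not_norm (c : K) (hc : Valued.v c ≤ 1) : Valued.v (-ε + 1 * (σ c * c)) = 1 := by
  rw [one_mul]
  by_contra hne
  have hle : Valued.v (-ε + σ c * c) ≤ 1 := by
    refine (Valuation.map_add _ _ _).trans (max_le ?_ ?_)
    · rw [Valuation.map_neg]; exact hε1.le
    · rw [Valuation.map_mul, hvσ]; exact mul_le_one' hc hc
  have hlt : Valued.v (-ε + σ c * c) < 1 := lt_of_le_of_ne hle hne
  -- then `|N(c)| = 1`
  have hN1 : Valued.v (σ c * c) = 1 := by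
    have h := Valuation.map_add_eq_of_lt_left (Valued.v) (x := ε) (y := -ε + σ c * c) (by rw [hε1]; exact hlt)
    rw [add_neg_cancel_left] at h
    rw [h, hε1]
  have hN0 : σ c * c ≠ 0 := fun h0 => by rw [h0, map_zero] at hN1; exact zero_ne_one hN1
  have hc0 : c ≠ 0 := fun h0 => hN0 (by rw [h0, mul_zero])
  -- `u := ε · N(c)⁻¹` is σ-fixed and `≡ 1`
  set u : K := ε * (σ c * c)⁻¹ with hu
  have hσN : σ (σ c * c) = σ c * c := by rw [map_mul, hσ, mul_comm]
  have hσu : σ u = u := by rw [hu, map_mul, map_inv₀, hσε, hσN]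
  have hu1 : Valued.v (u - 1) < 1 := by
    have e : u - 1 = (ε - σ c * c) * (σ c * c)⁻¹ := by rw [hu, sub_mul, mul_inv_cancel₀ hN0]
    rw [e, Valuation.map_mul, map_inv₀, hN1, inv_one, mul_one, Valuation.map_sub_swap, ← neg_add_eq_sub]
    exact hlt
  obtain ⟨z, hz⟩ := hnorm u hσu hu1
  refine hεn ⟨z * c, ?_⟩
  calc z * c * σ (z * c) = (z * σ z) * (σ c * c) := by rw [map_mul]; ring
    _ = u * (σ c * c) := by rw [hz]
    _ = ε := by rw [hu, inv_mul_cancel_right₀ hN0]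

include hσ hvσ hσε hε1 hεn hnorm in
/-- `|−ε·N(c) + 1| = 1` for integral `c`: otherwise `c` is a unit and `u := ε·N(c) ≡ 1` is a σ-fixed norm, so `ε = N(z∕c)`. [cite: Serre1979, Ch. V §3] [cite: LabesseLanglands1979, §2 p. 9] -/
theorem valued_neg_mul_norm_add_eq_one_of_not_norm (c : K) (hc : Valued.v c ≤ 1) : Valued.v (-ε * (σ c * c) + 1) = 1 := by
  by_contra hne
  have hle : Valued.v (-ε * (σ c * c) + 1) ≤ 1 := by
    refine (Valuation.map_add _ _ _).trans (max_le ?_ (by rw [Valuation.map_one]))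
    rw [Valuation.map_mul, Valuation.map_neg, hε1, one_mul, Valuation.map_mul, hvσ]; exact mul_le_one' hc hc
  have hlt : Valued.v (-ε * (σ c * c) + 1) < 1 := lt_of_le_of_ne hle hne
  -- `u := ε N(c)` is σ-fixed with `|u − 1| < 1`
  set u : K := ε * (σ c * c) with hu
  have hσu : σ u = u := by rw [hu, map_mul, map_mul, hσ, hσε]; ring
  have hu1 : Valued.v (u - 1) < 1 := by
    have e : u - 1 = -(-ε * (σ c * c) + 1) := by rw [hu]; ring
    rw [e, Valuation.map_neg]
    exact hlt
  have hN0 : σ c * c ≠ 0 := by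
    intro h0
    rw [hu, h0, mul_zero, zero_sub, Valuation.map_neg, Valuation.map_one] at hu1
    exact lt_irrefl _ hu1
  have hc0 : c ≠ 0 := fun h0 => hN0 (by rw [h0, mul_zero])
  obtain ⟨z, hz⟩ := hnorm u hσu hu1
  refine hεn ⟨z * c⁻¹, ?_⟩
  have hσc0 : σ c ≠ 0 := fun h0 => hN0 (by rw [h0, zero_mul])
  calc z * c⁻¹ * σ (z * c⁻¹) = (z * σ z) * (σ c * c)⁻¹ := by rw [map_mul, map_inv₀, mul_inv]; ring
    _ = u * (σ c * c)⁻¹ := by rw [hz]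
    _ = ε := by rw [hu, mul_inv_cancel_right₀ hN0]

include hσ hvσ hσε hε1 hεn hnorm in
/-- **`diag(−ε, 1)` IS RESIDUALLY ANISOTROPIC** for a σ-fixed NON-NORM unit `ε` (both valuation clauses of §1, `d = ![−ε, 1]`). [cite: Jacobowitz1962, §7] [cite: LabesseLanglands1979, §2 p. 9] -/
theorem anisotropic_diagonal_neg_of_not_norm :
    (∀ c : K, Valued.v c ≤ 1 → Valued.v ((![-ε, 1] : Fin 2 → K) 0 + (![-ε, 1] : Fin 2 → K) 1 * (σ c * c)) = 1) ∧
      (∀ c : K, Valued.v c ≤ 1 → Valued.v ((![-ε, 1] : Fin 2 → K) 0 * (σ c * c) + (![-ε, 1] : Fin 2 → K) 1) = 1) := by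
  have h0 : (![-ε, 1] : Fin 2 → K) 0 = -ε := rfl
  have h1 : (![-ε, 1] : Fin 2 → K) 1 = 1 := rfl
  refine ⟨fun c hc => ?_, fun c hc => ?_⟩
  · rw [h0, h1]; exact valued_neg_add_norm_eq_one_of_not_norm hσ hvσ hσε hε1 hεn hnorm c hc
  · rw [h0, h1]; exact valued_neg_mul_norm_add_eq_one_of_not_norm hσ hvσ hσε hε1 hεn hnorm c hc

include hσ hvσ hσε hε1 hεn hnorm in
/-- **HEAD (datum-free): on the anisotropic plane `diag(−ε, 1)` of a NON-NORM unit, every vertex lattice is the root** (`σ` a valuation-preserving involution, `|ϖ| = exp(−1)`,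
clause (norm)). [cite: BruhatTits1972, §10] [cite: Jacobowitz1962, §7–§8] [cite: LabesseLanglands1979, §2 pp. 8–10] -/
theorem eq_stdLattice_of_isVertex_diagonal_neg_of_not_norm {ϖ : K} (hϖ : Valued.v ϖ = WithZero.exp (-1 : ℤ))
    {M : Submodule 𝒪[K] (Fin 2 → K)} (hM : IsVertex σ ϖ (Matrix.diagonal (![-ε, 1] : Fin 2 → K)) M) : M = stdLattice K 2 := by
  obtain ⟨h₀, h₁⟩ := anisotropic_diagonal_neg_of_not_norm hσ hvσ hσε hε1 hεn hnorm
  have h0 : (![-ε, 1] : Fin 2 → K) 0 = -ε := rfl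
  have h1 : (![-ε, 1] : Fin 2 → K) 1 = 1 := rfl
  have hd : ∀ i, Valued.v ((![-ε, 1] : Fin 2 → K) i) = 1 := fun i => by
    fin_cases i
    · show Valued.v ((![-ε, 1] : Fin 2 → K) 0) = 1
      rw [h0, Valuation.map_neg, hε1]
    · show Valued.v ((![-ε, 1] : Fin 2 → K) 1) = 1
      rw [h1, Valuation.map_one]
  have hH : ((Matrix.diagonal (![-ε, 1] : Fin 2 → K)).map σ)ᵀ = Matrix.diagonal (![-ε, 1] : Fin 2 → K) := by
    rw [Matrix.diagonal_map (map_zero σ), Matrix.diagonal_transpose]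
    congr 1
    ext i; fin_cases i
    · show σ ((![-ε, 1] : Fin 2 → K) 0) = (![-ε, 1] : Fin 2 → K) 0
      rw [h0, map_neg, hσε]
    · show σ ((![-ε, 1] : Fin 2 → K) 1) = (![-ε, 1] : Fin 2 → K) 1
      rw [h1, map_one]
  exact eq_stdLattice_of_isVertex_of_anisotropic hσ hvσ hd h₀ h₁ hH hϖ hM

end NonNorm

end Literature.NumberTheory.Automorphic.UnitaryLatticeTree

/-! ## §5 The CM dress at a tame-ramified place: the anisotropic plane `diag(−η, 1)` of the (U2) unit -/

namespace Literature.NumberTheory.Automorphic.UnitaryGroup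

open Literature.NumberTheory.Automorphic Literature.NumberTheory.Automorphic.UnitaryLatticeTree Literature.NumberTheory.Automorphic.HermitianLattice

/-- **AT A TAME-RAMIFIED NON-SPLIT PLACE `w ∣ v` OF THE CM FIELD `L`** (`e(w|v) ≠ 1`, `|2|_w = 1`): for the fixed NON-NORM unit `η` of (U2) (★ `exists_fixed_unit_not_norm_of_ramified_complexConj`)
— equivalently any residue-non-square fixed unit — the hermitian plane `diag(−η, 1)` over `L_w` has the root `𝒪_w²` as its ONLY vertex lattice (any `ϖ` with `|ϖ| = exp(−1)`):
the `t₁` literal's plane `W′` of CERT P2ram (B-p14 (g38)) carries no tree. [cite: BruhatTits1972, §10] [cite: Jacobowitz1962, §7–§8] [cite: LabesseLanglands1979, §2 pp. 8–10] -/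
theorem eq_stdLattice_of_isVertex_anisotropicPlane_ramified (L : Type) [Field L] [NumberField L] [IsCMField L]
    {v : HeightOneSpectrum (𝓞 ↥(maximalRealSubfield L))} (w : PlacesOver L v) (hw : IsCMField.complexConj L • w.1 = w.1)
    (he : v.asIdeal.ramificationIdx' w.1.asIdeal ≠ 1) (h2 : Valued.v (2 : w.1.adicCompletion L) = 1)
    {η : w.1.adicCompletion L} (hη1 : Valued.v η = 1) (hση : galAdicCompletionMap (L := L) (IsCMField.complexConj L) hw η = η)
    (hηn : ¬ ∃ t : w.1.adicCompletion L, t * galAdicCompletionMap (L := L) (IsCMField.complexConj L) hw t = η)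
    {ϖ : w.1.adicCompletion L} (hϖ : Valued.v ϖ = WithZero.exp (-1 : ℤ))
    {M : Submodule 𝒪[w.1.adicCompletion L] (Fin 2 → w.1.adicCompletion L)}
    (hM : IsVertex (galAdicCompletionMap (L := L) (IsCMField.complexConj L) hw) ϖ (Matrix.diagonal (![-η, 1] : Fin 2 → w.1.adicCompletion L)) M) :
    M = stdLattice (w.1.adicCompletion L) 2 := by
  have hc1 : IsCMField.complexConj L ≠ 1 := IsCMField.complexConj_ne_one L
  obtain ⟨-, -, -, -, hnorm⟩ := Rogawski1990.ramifiedBlock_adicCompletion L (v := v) w hw he h2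
  exact eq_stdLattice_of_isVertex_diagonal_neg_of_not_norm (fun a => galAdicCompletionMap_galAdicCompletionMap_of_smul_eq (IsCMField.complexConj L) w hc1 hw a)
    (fun a => valued_galAdicCompletionMap (L := L) (IsCMField.complexConj L) hw a) hση hη1 hηn
    (fun u hu hu1 => by obtain ⟨z, hz, -⟩ := hnorm u hu hu1; exact ⟨z, hz⟩) hϖ hM

/-- **Existence form**: at a tame-ramified non-split place the (U2) unit `η` gives such a plane `diag(−η, 1)`. [cite: Jacobowitz1962, §7–§8] [cite: LabesseLanglands1979, §2 pp. 8–10] -/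
theorem exists_anisotropicPlane_eq_stdLattice_of_isVertex_ramified (L : Type) [Field L] [NumberField L] [IsCMField L]
    {v : HeightOneSpectrum (𝓞 ↥(maximalRealSubfield L))} (w : PlacesOver L v) (hw : IsCMField.complexConj L • w.1 = w.1)
    (he : v.asIdeal.ramificationIdx' w.1.asIdeal ≠ 1) (h2 : Valued.v (2 : w.1.adicCompletion L) = 1)
    {ϖ : w.1.adicCompletion L} (hϖ : Valued.v ϖ = WithZero.exp (-1 : ℤ)) :
    ∃ η : w.1.adicCompletion L, Valued.v η = 1 ∧ galAdicCompletionMap (L := L) (IsCMField.complexConj L) hw η = η ∧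
      (¬ ∃ t : w.1.adicCompletion L, t * galAdicCompletionMap (L := L) (IsCMField.complexConj L) hw t = η) ∧
      ∀ M : Submodule 𝒪[w.1.adicCompletion L] (Fin 2 → w.1.adicCompletion L),
        IsVertex (galAdicCompletionMap (L := L) (IsCMField.complexConj L) hw) ϖ (Matrix.diagonal (![-η, 1] : Fin 2 → w.1.adicCompletion L)) M →
          M = stdLattice (w.1.adicCompletion L) 2 := by
  obtain ⟨η, hη1, hση, -, hηn⟩ := Literature.NumberTheory.LocalFields.RamifiedPlaceUnitNorms.exists_fixed_unit_not_norm_of_ramified_complexConj L (v := v) w hw he h2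
  exact ⟨η, hη1, hση, hηn, fun M hM => eq_stdLattice_of_isVertex_anisotropicPlane_ramified L w hw he h2 hη1 hση hηn hϖ hM⟩

end Literature.NumberTheory.Automorphic.UnitaryGroup

end
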